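import Literature.GroupTheory.CombinatorialGroupTheory.MagnusFiltration
import HarnessLib

/-!
# Helper `helper_magnusRelationProduct` (Magnus expansions of relation products) for stub `stub_layerStepZeroThree`
of line `nilpotent-genus-class`, crux `CongruenceShadows.ShadowApproximation` (item stmt-SmoothPoincare4-14595)

A complement to the tree's Magnus formalism (`Literature/GroupTheory/CombinatorialGroupTheory/MagnusFiltration.lean`:
ring `A` with a descending filtration `E`, unit representation `ρ : G →* Aˣ` congruent to `1` modulo `E₁`), needed by
the certified evaluator of the `(0,3)` layer step (design `work/stubs/zeroThree/DESIGN.md` of the line folder): if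
`ρ(wᵢ) ≡ 1 (mod E_m)` for all `i`, then the RELATION PRODUCT `w = ∏ wᵢ ^ nᵢ` satisfies

  `ρ(w) - 1 ≡ ∑ nᵢ (ρ(wᵢ) - 1)  (mod E_{2m})`   (`magnusE_list_prod_zpow`),

i.e. BOTH the degree-`m … 2m-1` layers of the Magnus expansion are additive along such products — one layer more
than leading terms.  With `m = 4` (words in `γ₄(F₃)`, Magnus expansions `1 + (deg 4) + (deg 5) + ⋯`) this computes
the degree-`5` datum of a product of level-`3` constituents whose degree-`4` parts cancel, from the constituents
alone.  Elementary: `uv - 1 - ((u-1) + (v-1)) = (u-1)(v-1)` and `u⁻¹ - 1 + (u-1) = -(u-1)(u⁻¹-1)`.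
* `helper_magnusRelationProduct` — the registered closed form.
No definitions, no notations.
-/

set_option linter.dupNamespace false

noncomputable section

open Literature.GroupTheory.CombinatorialGroupTheory

namespace Summit.SmoothPoincare4.SmoothPoincare4.Theorems.ShadowApproximation.NilpotentGenusClass

namespace LayerZeroThree

section Magnus

variable {A : Type*} [Ring A] {E : ℕ → AddSubgroup A} (hE : IsDescFiltration E)
  {G : Type*} [Group G] (ρ : G →* Aˣ) (hρ : ∀ g, (ρ g : A) - 1 ∈ E 1) (m : ℕ)

include hE in
/-- Products: if `ρ x ≡ ρ y ≡ 1 (mod E_m)` then `ρ(xy) ≡ 1 (mod E_m)` and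
`ρ(xy) - 1 ≡ (ρ x - 1) + (ρ y - 1) (mod E_{2m})`. [folklore] -/
theorem magnusE_mul {x y : G} (hx : (ρ x : A) - 1 ∈ E m) (hy : (ρ y : A) - 1 ∈ E m) :
    (ρ (x * y) : A) - 1 ∈ E m ∧ (ρ (x * y) : A) - 1 - (((ρ x : A) - 1) + ((ρ y : A) - 1)) ∈ E (m + m) := by
  have e : (ρ (x * y) : A) - 1 = ((ρ x : A) - 1) + ((ρ y : A) - 1) + ((ρ x : A) - 1) * ((ρ y : A) - 1) := by
    rw [map_mul, Units.val_mul, mul_sub_one_eq]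
  refine ⟨?_, ?_⟩
  · rw [e]
    exact add_mem (add_mem hx hy) (hE.mem_of_le (Nat.le_add_right m m) (hE.mul_mem hx hy))
  · rw [e, add_sub_cancel_left]
    exact hE.mul_mem hx hy

include hE hρ in
/-- Inverses: if `ρ x ≡ 1 (mod E_m)` then `ρ x⁻¹ ≡ 1 (mod E_m)` and `ρ x⁻¹ - 1 ≡ -(ρ x - 1) (mod E_{2m})`. [folklore] -/
theorem magnusE_inv {x : G} (hx : (ρ x : A) - 1 ∈ E m) :
    (ρ x⁻¹ : A) - 1 ∈ E m ∧ (ρ x⁻¹ : A) - 1 + ((ρ x : A) - 1) ∈ E (m + m) := by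
  have e : (ρ x⁻¹ : A) - 1 = -(((ρ x : A) - 1) * (1 + ((ρ x⁻¹ : A) - 1))) := by
    have h1 : (ρ x⁻¹ : A) - 1 = -(((ρ x : A) - 1) * (((ρ x)⁻¹ : Aˣ) : A)) := by
      rw [map_inv]; exact units_inv_sub_one (ρ x)
    have h2 : (((ρ x)⁻¹ : Aˣ) : A) = 1 + ((ρ x⁻¹ : A) - 1) := by rw [map_inv]; abel
    rw [← h2]
    exact h1
  have h1 : (ρ x⁻¹ : A) - 1 ∈ E m := by
    rw [e]
    exact neg_mem (hE.mul_one_add_mem hx (hρ _))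
  refine ⟨h1, ?_⟩
  have e2 : (ρ x⁻¹ : A) - 1 + ((ρ x : A) - 1) = -(((ρ x : A) - 1) * ((ρ x⁻¹ : A) - 1)) := by
    conv_lhs => rw [e]
    noncomm_ring
  rw [e2]
  exact neg_mem (hE.mul_mem hx h1)

include hE hρ in
/-- Powers: if `ρ x ≡ 1 (mod E_m)` then `ρ (x ^ n) ≡ 1 (mod E_m)` and `ρ(x ^ n) - 1 ≡ n • (ρ x - 1) (mod E_{2m})`.
[folklore] -/
theorem magnusE_zpow {x : G} (hx : (ρ x : A) - 1 ∈ E m) (n : ℤ) :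
    (ρ (x ^ n) : A) - 1 ∈ E m ∧ (ρ (x ^ n) : A) - 1 - n • ((ρ x : A) - 1) ∈ E (m + m) := by
  induction n using Int.induction_on with
  | zero =>
    rw [zpow_zero, map_one, Units.val_one, sub_self, zero_smul, sub_zero]
    exact ⟨zero_mem _, zero_mem _⟩
  | succ n ih =>
    obtain ⟨ih1, ih2⟩ := ih
    obtain ⟨h1, h2⟩ := magnusE_mul hE ρ m ih1 hx
    rw [zpow_add_one]
    refine ⟨h1, ?_⟩
    have e : (ρ (x ^ (n : ℤ) * x) : A) - 1 - ((n : ℤ) + 1) • ((ρ x : A) - 1) =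
        ((ρ (x ^ (n : ℤ) * x) : A) - 1 - (((ρ (x ^ (n : ℤ)) : A) - 1) + ((ρ x : A) - 1))) +
          (((ρ (x ^ (n : ℤ)) : A) - 1) - (n : ℤ) • ((ρ x : A) - 1)) := by
      rw [add_smul, one_smul]; abel
    rw [e]
    exact add_mem h2 ih2
  | pred n ih =>
    obtain ⟨ih1, ih2⟩ := ih
    obtain ⟨hi1, hi2⟩ := magnusE_inv hE ρ hρ m hx
    obtain ⟨h1, h2⟩ := magnusE_mul hE ρ m ih1 hi1
    rw [zpow_sub_one]
    refine ⟨h1, ?_⟩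
    have e : (ρ (x ^ (-(n : ℤ)) * x⁻¹) : A) - 1 - (-(n : ℤ) - 1) • ((ρ x : A) - 1) =
        ((ρ (x ^ (-(n : ℤ)) * x⁻¹) : A) - 1 - (((ρ (x ^ (-(n : ℤ))) : A) - 1) + ((ρ x⁻¹ : A) - 1))) +
          (((ρ (x ^ (-(n : ℤ))) : A) - 1) - (-(n : ℤ)) • ((ρ x : A) - 1)) +
          (((ρ x⁻¹ : A) - 1) + ((ρ x : A) - 1)) := by
      rw [sub_smul, one_smul]; abel
    rw [e]
    exact add_mem (add_mem h2 ih2) hi2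

include hE hρ in
/-- **Magnus expansions of relation products.** If `ρ(wᵢ) ≡ 1 (mod E_m)` for all `i`, then the product
`w = ∏ wᵢ ^ nᵢ` has `ρ(w) ≡ 1 (mod E_m)` and `ρ(w) - 1 ≡ ∑ nᵢ (ρ(wᵢ) - 1) (mod E_{2m})`. [folklore] -/
theorem magnusE_list_prod_zpow {ι : Type*} (l : List ι) (w : ι → G) (n : ι → ℤ)
    (hw : ∀ i, (ρ (w i) : A) - 1 ∈ E m) :
    (ρ (l.map fun i => w i ^ n i).prod : A) - 1 ∈ E m ∧
    (ρ (l.map fun i => w i ^ n i).prod : A) - 1 - (l.map fun i => n i • ((ρ (w i) : A) - 1)).sum ∈ E (m + m) := by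
  induction l with
  | nil =>
    rw [List.map_nil, List.map_nil, List.prod_nil, List.sum_nil, map_one, Units.val_one, sub_self, sub_zero]
    exact ⟨zero_mem _, zero_mem _⟩
  | cons i l ih =>
    obtain ⟨ih1, ih2⟩ := ih
    obtain ⟨hz1, hz2⟩ := magnusE_zpow hE ρ hρ m (hw i) (n i)
    obtain ⟨h1, h2⟩ := magnusE_mul hE ρ m hz1 ih1
    rw [List.map_cons, List.map_cons, List.prod_cons, List.sum_cons]
    refine ⟨h1, ?_⟩
    have e : (ρ (w i ^ n i * (l.map fun i => w i ^ n i).prod) : A) - 1 -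
          (n i • ((ρ (w i) : A) - 1) + (l.map fun i => n i • ((ρ (w i) : A) - 1)).sum) =
        ((ρ (w i ^ n i * (l.map fun i => w i ^ n i).prod) : A) - 1 -
            (((ρ (w i ^ n i) : A) - 1) + ((ρ (l.map fun i => w i ^ n i).prod : A) - 1))) +
          (((ρ (w i ^ n i) : A) - 1) - n i • ((ρ (w i) : A) - 1)) +
          (((ρ (l.map fun i => w i ^ n i).prod : A) - 1) - (l.map fun i => n i • ((ρ (w i) : A) - 1)).sum) := by
      abel
    rw [e]
    exact add_mem (add_mem h2 hz2) ih2

end Magnus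

end LayerZeroThree

/-- **Registered helper `helper_magnusRelationProduct`** (sub-goal of stub `stub_layerStepZeroThree`, item
stmt-SmoothPoincare4-14595): Magnus expansions of relation products, in closed form — for a unit representation
`ρ : G →* Aˣ` congruent to `1` modulo a descending ring filtration `E` and elements `wᵢ` with `ρ(wᵢ) ≡ 1 (mod E_m)`,
the product `w = ∏ wᵢ ^ nᵢ` has `ρ(w) ≡ 1 (mod E_m)` and `ρ(w) - 1 ≡ ∑ nᵢ (ρ(wᵢ) - 1) (mod E_{2m})`. [folklore] -/
theorem helper_magnusRelationProduct : ∀ {A : Type*} [Ring A] (E : ℕ → AddSubgroup A), Literature.GroupTheory.CombinatorialGroupTheory.IsDescFiltration E → ∀ {G : Type*} [Group G] (ρ : G →* Aˣ), (∀ g, (ρ g : A) - 1 ∈ E 1) → ∀ (m : ℕ) {ι : Type*} (l : List ι) (w : ι → G) (n : ι → ℤ), (∀ i, (ρ (w i) : A) - 1 ∈ E m) → (ρ (l.map fun i => w i ^ n i).prod : A) - 1 ∈ E m ∧ (ρ (l.map fun i => w i ^ n i).prod : A) - 1 - (l.map fun i => n i • ((ρ (w i) : A) - 1)).sum ∈ E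 (m + m) :=
  fun _ hE _ _ ρ hρ m _ l w n hw => LayerZeroThree.magnusE_list_prod_zpow hE ρ hρ m l w n hw

end Summit.SmoothPoincare4.SmoothPoincare4.Theorems.ShadowApproximation.NilpotentGenusClass

end
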